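/-
Copyright (c) 2026. All rights reserved.
Released under Apache 2.0 license as described in the file LICENSE.
-/
import Literature.NumberTheory.ComplexMultiplication.DegenerateCMTypesCyclicPrimePower
import HarnessLib

/-!
# Odd characters on a CM type of an abelian group of order `2p^k`: the vanishing criterion on the FIBRES, and
# the balanced set `ker χ ∪ ρu^{p^j} ker χ` of a degenerate type (Lenstra's nondivisorial Hodge cycle, group level)

T. Kubota's Lemma 2 [Kubota1965] reads the rank of a CM type `(K; S)` with abelian Galois group `G` on the odd
characters `χ` of `G`: `rank = 1 + #{χ odd : χ(S) ≠ 0}`.  F. Hazama [Hazama2003CyclicCM] (cyclic `G`) and the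
companion files `DegenerateCMTypesCyclicPrimePower` (cyclic of order `2p^k`), `DegenerateCMTypesElementaryAbelian…`
(`⟨ρ⟩ × (ℤ/p)²`) decide `χ(S) = 0` in COORDINATES.  THIS FILE does it WITHOUT coordinates, for every finite
abelian group and every odd character `χ` whose values are `2p^{j+1}`-th roots of unity containing a primitive
`p^{j+1}`-th root of unity `χ(u)` (`p` odd) — on a group of order `2p^k` EVERY odd character vanishing on a type
is of this kind (`exists_isPrimitiveRoot_of_sum_char_eq_zero`):

  `χ(S) = Σ_{c ∈ ℤ/p^{j+1}} (2N(χ(u)^c) − #ker χ)·χ(u)^c`,  `N(v) = #{s ∈ S : χ(s) = v}`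

(`ρ` swaps the fibres over `v` and `−v` and `S` with its complement: `N(−v) = #ker χ − N(v)`), and the only
rational relation of degree `< p^{j+1}` among the `p^{j+1}`-th roots of unity is `Φ_p(X^{p^j})`
(`PrimePow.sum_mul_pow_eq_zero_iff_periodic`), so **`χ(S) = 0` iff `N(vζ) = N(v)` for every value `v` of `χ`**,
`ζ = χ(u)^{p^j}`: `S` is equidistributed among the `p` cosets of `ker χ` inside each coset of `ker χᵖ`.  Then
**`Δ = ker χ ∪ ρu^{p^j} ker χ` is a balanced weight** (`#(gΔ ∩ S) = #ker χ` for all `g`) of size `2·#ker χ`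
containing `1` and not `ρ` — the input of Pohlmann's criterion: F. Hazama, Rem. 4.10: "It is shown by Lenstra
that for any abelian variety `A` with complex multiplication by an abelian CM-field, there always exists a
nondivisorial Hodge cycle on `A` itself if `A` is degenerate"; here for all abelian CM fields of degree `2p^k`
(the number-field dress is `Pohlmann1968/DegenerateCMTypesAbelianCMFieldPrimePower`).

## What is PROVED (theorems only; no definition, no named fact, no `sorry`)

* §1 `card_fibre_mul` (all fibres over values have the size of `ker χ`), **`card_filter_neg`**
  (`N(−v) = #χ⁻¹(v) − N(v)`).
* §2 **`sum_char_eq_sum_fibres`**, `sum_char_eq_sum_fibres'` (`χ(S) = Σ_c (2N(χ(u)^c) − #ker χ) χ(u)^c`),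
  **`sum_char_eq_zero_iff_fibres`** (THE CRITERION: `χ(S) = 0 ⟺ ∀ g, N(χ(g)ζ) = N(χ(g))`).
* §3 `card_fibreSet` (`2·#ker χ`), **`isBalanced_fibreSet`**, `one_mem_rho_not_mem_fibreSet`.
* §4 (`|G| = 2p^k`) `sum_char_ne_zero_of_sq_eq_one` (a `±1`-valued character never vanishes: `#S = p^k` is odd),
  **`exists_isPrimitiveRoot_of_sum_char_eq_zero`** (a vanishing odd character has a primitive `p^{j+1}`-th root
  of unity `χ(u)` among its values, all of which are `2p^{j+1}`-th roots of unity — `χ(g)²` of maximal order),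
  **`exists_balanced_of_sum_char_eq_zero`** (the balanced, non-symmetric `Δ` of size `2·#ker χ`),
  `card_ker_pos_le` (`0 < #ker χ ≤ p^k`).

## References

* [Kubota1965] T. Kubota, Trans. AMS 118 (1965), §4 Lemma 2.
* [Hazama2003CyclicCM] F. Hazama, J. Math. Sci. Univ. Tokyo 10 (2003): Prop. 4.1, Prop. 4.3, Lemma 4.6.1,
  Rem. 4.10, §5.
* [Gordon1999HodgeAVSurvey] B. B. Gordon, 9.2.2, §9.3 (White, Lenstra), 9.4.1.
* [Dodson1987] B. Dodson, J. Algebra 111 (1987), §4.1.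

## Provenance

Lane `lit-hodgefound` (Track 2, Layer A3 — CM types), seat `lit-hodgefound-p10` generation 35, row g35-#15;
neighbours cited by name, nothing restated: `DegenerateCMTypesCyclicPrimePower`
(`PrimePow.sum_mul_pow_eq_zero_iff_periodic`), `DegenerateCMTypesCyclicTwoOddPrimes` (`IsBalanced`,
`isBalanced_indicator_iff`, `rho_mul_mem_iff`), `CMTypeRankCharacters` (Kubota's Lemma 2).
-/

open scoped BigOperators

namespace Literature.NumberTheory.ComplexMultiplication

namespace CyclicCMType

namespace AbelianPrimePow

variable {G : Type*} [CommGroup G] [Fintype G] [DecidableEq G] {p : ℕ} [hp : Fact p.Prime] {ρ : G} {Φ : Finset G}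

/-! ## §1 Characters: fibres and values -/

omit [Fintype G] [DecidableEq G] hp in
/-- `χ(gh) = χ(g)χ(h)`. [folklore] -/
private theorem char_mul (χ : AddChar (Additive G) ℂ) (g h : G) :
    χ (Additive.ofMul (g * h)) = χ (Additive.ofMul g) * χ (Additive.ofMul h) := by
  rw [ofMul_mul, AddChar.map_add_eq_mul]

omit [Fintype G] [DecidableEq G] hp in
/-- `χ(g^e) = χ(g)^e`. [folklore] -/
private theorem char_pow (χ : AddChar (Additive G) ℂ) (g : G) (e : ℕ) :
    χ (Additive.ofMul (g ^ e)) = χ (Additive.ofMul g) ^ e := by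
  rw [ofMul_pow, AddChar.map_nsmul_eq_pow]

omit [Fintype G] [DecidableEq G] hp in
/-- `χ(g) ≠ 0`. [folklore] -/
private theorem char_ne_zero (χ : AddChar (Additive G) ℂ) (g : G) : χ (Additive.ofMul g) ≠ 0 := by
  intro h0
  have := char_mul χ g g⁻¹
  rw [mul_inv_cancel, ofMul_one, AddChar.map_zero_eq_one, h0, zero_mul] at this
  exact one_ne_zero this

omit [DecidableEq G] hp in
/-- `χ(g)^{|G|} = 1`. [folklore] -/
private theorem char_pow_card (χ : AddChar (Additive G) ℂ) (g : G) : χ (Additive.ofMul g) ^ Fintype.card G = 1 := by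
  rw [← char_pow, pow_card_eq_one, ofMul_one, AddChar.map_zero_eq_one]

omit [DecidableEq G] hp in
/-- **Translating a fibre**: `#{d : χ(d) = v, P(g₀d)} = #{s : χ(s) = χ(g₀)v, P(s)}`. [folklore] -/
private theorem card_filter_translate (χ : AddChar (Additive G) ℂ) (g₀ : G) (v : ℂ) (P : G → Prop)
    [DecidablePred P] :
    (Finset.univ.filter fun d : G => χ (Additive.ofMul d) = v ∧ P (g₀ * d)).card =
      (Finset.univ.filter fun s : G => χ (Additive.ofMul s) = χ (Additive.ofMul g₀) * v ∧ P s).card := by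
  refine Finset.card_bij (fun d _ => g₀ * d) (fun d hd => ?_) (fun d _ d' _ h => mul_left_cancel h)
    fun s hs => ⟨g₀⁻¹ * s, ?_, by rw [mul_inv_cancel_left]⟩
  · rw [Finset.mem_filter] at hd ⊢
    refine ⟨Finset.mem_univ _, ?_, hd.2.2⟩
    rw [char_mul, hd.2.1]
  · rw [Finset.mem_filter] at hs ⊢
    refine ⟨Finset.mem_univ _, ?_, by rw [mul_inv_cancel_left]; exact hs.2.2⟩
    have h1 := char_mul χ g₀ (g₀⁻¹ * s)
    rw [mul_inv_cancel_left, hs.2.1] at h1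
    exact (mul_left_cancel₀ (char_ne_zero χ g₀) h1).symm

omit [DecidableEq G] hp in
/-- **All fibres of `χ` over its values have the same size** (`#χ⁻¹(χ(g₀)v) = #χ⁻¹(v)`: cosets of `ker χ`).
[cite: Kubota1965, §4 Lemma 2 (proof)] -/
theorem card_fibre_mul (χ : AddChar (Additive G) ℂ) (g₀ : G) (v : ℂ) :
    (Finset.univ.filter fun s : G => χ (Additive.ofMul s) = χ (Additive.ofMul g₀) * v).card =
      (Finset.univ.filter fun d : G => χ (Additive.ofMul d) = v).card := by
  have := card_filter_translate χ g₀ v (fun _ => True)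
  simp only [and_true] at this
  exact this.symm

omit hp in
/-- **The type on the opposite fibre**: `#{s ∈ S : χ(s) = −v} = #χ⁻¹(v) − #{s ∈ S : χ(s) = v}` (`ρ` swaps the
fibres over `v` and `−v`, and `S` with its complement). [cite: Kubota1965, §4 Lemma 2 (proof)] -/
theorem card_filter_neg (h : IsCMTypeWith ρ (Φ : Set G)) (χ : AddChar (Additive G) ℂ)
    (hχ : χ (Additive.ofMul ρ) = -1) (v : ℂ) :
    (Φ.filter fun s => χ (Additive.ofMul s) = -v).card =
      (Finset.univ.filter fun d : G => χ (Additive.ofMul d) = v).card -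
        (Φ.filter fun s => χ (Additive.ofMul s) = v).card := by
  have h1 := card_filter_translate χ ρ v (· ∈ Φ)
  rw [hχ, neg_one_mul] at h1
  have h2 : (Finset.univ.filter fun s : G => χ (Additive.ofMul s) = -v ∧ s ∈ Φ) =
      Φ.filter fun s => χ (Additive.ofMul s) = -v := by
    ext s; simp only [Finset.mem_filter, Finset.mem_univ, true_and]; tauto
  have h3 : (Finset.univ.filter fun d : G => χ (Additive.ofMul d) = v ∧ ρ * d ∈ Φ) =
      (Finset.univ.filter fun d : G => χ (Additive.ofMul d) = v) \
        Φ.filter fun s => χ (Additive.ofMul s) = v := by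
    ext d
    simp only [Finset.mem_filter, Finset.mem_univ, true_and, Finset.mem_sdiff, rho_mul_mem_iff h]
    tauto
  rw [← h2, ← h1, h3, Finset.card_sdiff_of_subset]
  intro d hd
  simp only [Finset.mem_filter, Finset.mem_univ, true_and] at hd ⊢
  exact hd.2

/-! ## §2 The character sum on a CM type, read on the fibres -/

section Values

variable {u : G} {j : ℕ} {χ : AddChar (Additive G) ℂ}

omit [Fintype G] [DecidableEq G] in
/-- **The values of `χ` are `±χ(u)^c`** when `χ(u)` is a primitive `p^{j+1}`-th root of unity and all values are
`2p^{j+1}`-th roots of unity (`p` odd). [folklore] -/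
private theorem exists_value_eq (hp2 : p ≠ 2) (hu : IsPrimitiveRoot (χ (Additive.ofMul u)) (p ^ (j + 1)))
    (hall : ∀ g : G, χ (Additive.ofMul g) ^ (2 * p ^ (j + 1)) = 1) (g : G) :
    ∃ c : ZMod (p ^ (j + 1)), χ (Additive.ofMul g) = χ (Additive.ofMul u) ^ c.val ∨
      χ (Additive.ofMul g) = -χ (Additive.ofMul u) ^ c.val := by
  set w := χ (Additive.ofMul g) with hw
  have hsq : (w ^ p ^ (j + 1)) ^ 2 = 1 := by rw [← pow_mul, mul_comm]; exact hall g
  have hodd : Odd (p ^ (j + 1)) := (hp.out.odd_of_ne_two hp2).pow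
  rcases sq_eq_one_iff.1 hsq with h1 | h1
  · obtain ⟨i, -, hi⟩ := hu.eq_pow_of_pow_eq_one h1
    refine ⟨(i : ZMod (p ^ (j + 1))), Or.inl ?_⟩
    rw [ZMod.val_natCast, ← hi, hu.eq_orderOf, pow_mod_orderOf]
  · have h2 : (-w) ^ p ^ (j + 1) = 1 := by rw [hodd.neg_pow, h1, neg_neg]
    obtain ⟨i, -, hi⟩ := hu.eq_pow_of_pow_eq_one h2
    refine ⟨(i : ZMod (p ^ (j + 1))), Or.inr ?_⟩
    rw [ZMod.val_natCast, show w = -(-w) from (neg_neg w).symm, ← hi, hu.eq_orderOf, pow_mod_orderOf]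

omit [Fintype G] [DecidableEq G] in
/-- `χ(u)^c = χ(u)^{c'}` forces `c = c'` in `ℤ/p^{j+1}`. [folklore] -/
private theorem pow_val_injective (hu : IsPrimitiveRoot (χ (Additive.ofMul u)) (p ^ (j + 1)))
    {c c' : ZMod (p ^ (j + 1))} (h : χ (Additive.ofMul u) ^ c.val = χ (Additive.ofMul u) ^ c'.val) : c = c' :=
  ZMod.val_injective _ (hu.pow_inj (ZMod.val_lt c) (ZMod.val_lt c') h)

omit [Fintype G] [DecidableEq G] in
/-- `χ(u)^a ≠ −χ(u)^b` (`−1` is not a `p^{j+1}`-th root of unity, `p` odd). [folklore] -/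
private theorem pow_ne_neg_pow (hp2 : p ≠ 2) (hu : IsPrimitiveRoot (χ (Additive.ofMul u)) (p ^ (j + 1)))
    (a b : ℕ) : χ (Additive.ofMul u) ^ a ≠ -χ (Additive.ofMul u) ^ b := by
  intro h
  have hodd : Odd (p ^ (j + 1)) := (hp.out.odd_of_ne_two hp2).pow
  have h1 : (χ (Additive.ofMul u) ^ a) ^ p ^ (j + 1) = 1 := by
    rw [← pow_mul, mul_comm, pow_mul, hu.pow_eq_one, one_pow]
  have h2 : (-χ (Additive.ofMul u) ^ b) ^ p ^ (j + 1) = -1 := by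
    rw [hodd.neg_pow, ← pow_mul, mul_comm, pow_mul, hu.pow_eq_one, one_pow]
  rw [h, h2] at h1
  norm_num at h1

omit [Fintype G] [DecidableEq G] in
/-- `χ(u)^{(c + m).val} = χ(u)^{c.val} χ(u)^m`. [folklore] -/
private theorem pow_val_add (hu : IsPrimitiveRoot (χ (Additive.ofMul u)) (p ^ (j + 1)))
    (c : ZMod (p ^ (j + 1))) (m : ℕ) :
    χ (Additive.ofMul u) ^ (c + (m : ZMod (p ^ (j + 1)))).val = χ (Additive.ofMul u) ^ c.val *
      χ (Additive.ofMul u) ^ m := by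
  have h1 := pow_mod_orderOf (χ (Additive.ofMul u)) (c.val + m % p ^ (j + 1))
  have h2 := pow_mod_orderOf (χ (Additive.ofMul u)) m
  rw [← hu.eq_orderOf] at h1 h2
  rw [ZMod.val_add, ZMod.val_natCast, h1, pow_add, h2]

omit [Fintype G] [DecidableEq G] in
/-- **The character sum on the fibres**: `χ(S) = Σ_{c ∈ ℤ/p^{j+1}} (N(ω^c) − N(−ω^c)) ω^c`, `ω = χ(u)`,
`N(v) = #{s ∈ S : χ(s) = v}`. [cite: Kubota1965, §4 Lemma 2 (proof)] [cite: Hazama2003CyclicCM, Prop. 4.1] -/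
theorem sum_char_eq_sum_fibres (hp2 : p ≠ 2) (hu : IsPrimitiveRoot (χ (Additive.ofMul u)) (p ^ (j + 1)))
    (hall : ∀ g : G, χ (Additive.ofMul g) ^ (2 * p ^ (j + 1)) = 1) (Φ : Finset G) :
    ∑ s ∈ Φ, χ (Additive.ofMul s) = ∑ c : ZMod (p ^ (j + 1)),
      (((Φ.filter fun s => χ (Additive.ofMul s) = χ (Additive.ofMul u) ^ c.val).card : ℂ) -
        ((Φ.filter fun s => χ (Additive.ofMul s) = -χ (Additive.ofMul u) ^ c.val).card : ℂ)) *
        χ (Additive.ofMul u) ^ c.val := by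
  set ω := χ (Additive.ofMul u) with hωdef
  -- pointwise: exactly one of the `2p^{j+1}` indicator terms is `χ(s)`
  have hpt : ∀ s : G, χ (Additive.ofMul s) = ∑ c : ZMod (p ^ (j + 1)),
      ((if χ (Additive.ofMul s) = ω ^ c.val then ω ^ c.val else 0) +
        (if χ (Additive.ofMul s) = -ω ^ c.val then -ω ^ c.val else 0)) := by
    intro s
    obtain ⟨c₀, hc₀⟩ := exists_value_eq hp2 hu hall s
    rw [Finset.sum_eq_single c₀]
    · rcases hc₀ with h0 | h0
      · rw [if_pos h0, if_neg, add_zero]; · exact h0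
        rw [h0]; exact pow_ne_neg_pow hp2 hu _ _
      · rw [if_neg, if_pos h0, zero_add]; · exact h0
        rw [h0]; exact fun h' => pow_ne_neg_pow hp2 hu _ _ h'.symm
    · intro c _ hc
      rw [if_neg, if_neg, add_zero]
      · intro h'
        rcases hc₀ with h0 | h0
        · rw [h0] at h'; exact pow_ne_neg_pow hp2 hu _ _ h'
        · rw [h0, neg_inj] at h'; exact hc (pow_val_injective hu h').symm
      · intro h'
        rcases hc₀ with h0 | h0
        · rw [h0] at h'; exact hc (pow_val_injective hu h').symm
        · rw [h0] at h'; exact pow_ne_neg_pow hp2 hu _ _ h'.symm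
    · intro h'; exact absurd (Finset.mem_univ _) h'
  rw [Finset.sum_congr rfl fun s _ => hpt s, Finset.sum_comm]
  refine Finset.sum_congr rfl fun c _ => ?_
  rw [Finset.sum_add_distrib, ← Finset.sum_filter, ← Finset.sum_filter, Finset.sum_const, Finset.sum_const,
    nsmul_eq_mul, nsmul_eq_mul]
  ring

/-- **The character sum, reduced**: `χ(S) = Σ_c (2N(ω^c) − M) ω^c` with `M = #ker χ` the common fibre size.
[cite: Kubota1965, §4 Lemma 2 (proof)] [cite: Hazama2003CyclicCM, Prop. 4.1 ((4.1))] -/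
theorem sum_char_eq_sum_fibres' (hp2 : p ≠ 2) (h : IsCMTypeWith ρ (Φ : Set G))
    (hχ : χ (Additive.ofMul ρ) = -1) (hu : IsPrimitiveRoot (χ (Additive.ofMul u)) (p ^ (j + 1)))
    (hall : ∀ g : G, χ (Additive.ofMul g) ^ (2 * p ^ (j + 1)) = 1) :
    ∑ s ∈ Φ, χ (Additive.ofMul s) = ∑ c : ZMod (p ^ (j + 1)),
      ((2 * ((Φ.filter fun s => χ (Additive.ofMul s) = χ (Additive.ofMul u) ^ c.val).card : ℤ) -
        (Finset.univ.filter fun d : G => χ (Additive.ofMul d) = 1).card : ℤ) : ℂ) *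
        χ (Additive.ofMul u) ^ c.val := by
  rw [sum_char_eq_sum_fibres hp2 hu hall Φ]
  refine Finset.sum_congr rfl fun c _ => ?_
  have hM : (Finset.univ.filter fun d : G => χ (Additive.ofMul d) = χ (Additive.ofMul u) ^ c.val).card =
      (Finset.univ.filter fun d : G => χ (Additive.ofMul d) = 1).card := by
    rw [← card_fibre_mul χ (u ^ c.val) 1, char_pow, mul_one]
  have hle : (Φ.filter fun s => χ (Additive.ofMul s) = χ (Additive.ofMul u) ^ c.val).card ≤
      (Finset.univ.filter fun d : G => χ (Additive.ofMul d) = χ (Additive.ofMul u) ^ c.val).card :=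
    Finset.card_le_card (fun s hs => by
      simp only [Finset.mem_filter, Finset.mem_univ, true_and] at hs ⊢; exact hs.2)
  rw [card_filter_neg h χ hχ, Nat.cast_sub hle, hM]
  push_cast
  ring

/-- **THE VANISHING CRITERION ON THE FIBRES** (any finite abelian group, `p` odd): for an odd character `χ` whose
values are `2p^{j+1}`-th roots of unity and contain a primitive `p^{j+1}`-th root of unity `χ(u)`, `χ(S) = 0`
iff the type `S` meets the fibres `χ⁻¹(v)` and `χ⁻¹(vζ)` in equally many points for every value `v = χ(g)`, where
`ζ = χ(u)^{p^j}` (a primitive `p`-th root of unity) — `S` is EQUIDISTRIBUTED among the `p` cosets of `ker χ`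
inside each coset of `ker χ^p`.  (The only rational relation among the `p^{j+1}`-th roots of unity in degree
`< p^{j+1}` is `Φ_p(X^{p^j})`.)  On `⟨ρ⟩ × ℤ_{p^k}` these are the LEVELS of `DegenerateCMTypesCyclicPrimePower`.
[cite: Kubota1965, §4 Lemma 2] [cite: Hazama2003CyclicCM, Prop. 4.3 and Lemma 4.6.1] -/
theorem sum_char_eq_zero_iff_fibres (hp2 : p ≠ 2) (h : IsCMTypeWith ρ (Φ : Set G))
    (hχ : χ (Additive.ofMul ρ) = -1) (hu : IsPrimitiveRoot (χ (Additive.ofMul u)) (p ^ (j + 1)))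
    (hall : ∀ g : G, χ (Additive.ofMul g) ^ (2 * p ^ (j + 1)) = 1) :
    ∑ s ∈ Φ, χ (Additive.ofMul s) = 0 ↔ ∀ g : G,
      (Φ.filter fun s => χ (Additive.ofMul s) =
          χ (Additive.ofMul g) * χ (Additive.ofMul u) ^ p ^ j).card =
        (Φ.filter fun s => χ (Additive.ofMul s) = χ (Additive.ofMul g)).card := by
  haveI : NeZero (p ^ j) := inferInstance
  rw [sum_char_eq_sum_fibres' hp2 h hχ hu hall,
    PrimePow.sum_mul_pow_eq_zero_iff_periodic (p := p) (q := p ^ j) (m := j) rfl (pow_succ' p j) hu]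
  have hfib : ∀ v : ℂ, ∀ g₀ : G, v = χ (Additive.ofMul g₀) →
      (Finset.univ.filter fun d : G => χ (Additive.ofMul d) = v).card =
        (Finset.univ.filter fun d : G => χ (Additive.ofMul d) = 1).card := by
    rintro v g₀ rfl
    rw [← card_fibre_mul χ g₀ 1, mul_one]
  constructor
  · intro H g
    obtain ⟨c, hc | hc⟩ := exists_value_eq hp2 hu hall g
    · have Hc := H c
      rw [pow_val_add hu] at Hc
      rw [hc]
      omega
    · -- the opposite fibres: `N(−v) = M − N(v)`
      have Hc := H c
      rw [pow_val_add hu] at Hc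
      rw [hc, neg_mul, card_filter_neg h χ hχ, card_filter_neg h χ hχ,
        hfib (χ (Additive.ofMul u) ^ c.val * χ (Additive.ofMul u) ^ p ^ j) (u ^ c.val * u ^ p ^ j)
          (by rw [char_mul, char_pow, char_pow]),
        hfib (χ (Additive.ofMul u) ^ c.val) (u ^ c.val) (by rw [char_pow])]
      omega
  · intro H c
    have Hc := H (u ^ c.val)
    rw [char_pow] at Hc
    rw [pow_val_add hu]
    omega

end Values

/-! ## §3 The balanced set `ker χ ∪ ρu^{p^j} ker χ` -/

section Balanced

variable {u : G} {j : ℕ} {χ : AddChar (Additive G) ℂ}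

omit hp in
/-- **`#(ker χ ∪ ρu^{p^j} ker χ) = 2 · #ker χ`.** [cite: Hazama2003CyclicCM, §5] -/
theorem card_fibreSet (hχ : χ (Additive.ofMul ρ) = -1) (hζ1 : χ (Additive.ofMul u) ^ p ^ j ≠ -1) :
    (Finset.univ.filter fun d : G => χ (Additive.ofMul d) = 1 ∨
      χ (Additive.ofMul d) = -χ (Additive.ofMul u) ^ p ^ j).card =
      2 * (Finset.univ.filter fun d : G => χ (Additive.ofMul d) = 1).card := by
  rw [Finset.filter_or, Finset.card_union_of_disjoint, two_mul]
  · congr 1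
    rw [← card_fibre_mul χ (ρ * u ^ p ^ j) 1, char_mul, char_pow, hχ, mul_one, neg_one_mul]
  · rw [Finset.disjoint_filter]
    intro d _ h1 h2
    rw [h1] at h2
    exact hζ1 (by rw [h2, neg_neg])

/-- **`Δ = ker χ ∪ ρu^{p^j} ker χ` is a balanced weight for every type equidistributed along `χ`** (Pohlmann's
condition `#(gΔ ∩ S) = #ker χ` for all `g`: the translate `g ker χ = χ⁻¹(χ(g))` meets `S` in `N(χ(g))` points,
the translate `gρu^{p^j} ker χ = χ⁻¹(−ζχ(g))` in `M − N(ζχ(g)) = M − N(χ(g))` points).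
[cite: Hazama2003CyclicCM, §5 (5.1)–(5.3)] [cite: Gordon1999HodgeAVSurvey, §9.2 (9.2.1)] -/
theorem isBalanced_fibreSet (hp2 : p ≠ 2) (h : IsCMTypeWith ρ (Φ : Set G)) (hχ : χ (Additive.ofMul ρ) = -1)
    (hu : IsPrimitiveRoot (χ (Additive.ofMul u)) (p ^ (j + 1)))
    (hall : ∀ g : G, χ (Additive.ofMul g) ^ (2 * p ^ (j + 1)) = 1)
    (h0 : ∑ s ∈ Φ, χ (Additive.ofMul s) = 0) :
    IsBalanced G (Φ : Set G) (fun d => if d ∈ (Finset.univ.filter fun d : G => χ (Additive.ofMul d) = 1 ∨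
      χ (Additive.ofMul d) = -χ (Additive.ofMul u) ^ p ^ j) then (1 : ℚ) else 0) := by
  have hprim : IsPrimitiveRoot (χ (Additive.ofMul u) ^ p ^ j) p :=
    hu.pow (pow_pos hp.out.pos _) (by rw [← pow_succ])
  have hζ : χ (Additive.ofMul u) ^ p ^ j ≠ 1 := hprim.ne_one hp.out.one_lt
  have hζ1 : χ (Additive.ofMul u) ^ p ^ j ≠ -1 := by
    intro h1
    have := hprim.pow_eq_one
    rw [h1, (hp.out.odd_of_ne_two hp2).neg_one_pow] at this
    norm_num at this
  have H := (sum_char_eq_zero_iff_fibres hp2 h hχ hu hall).1 h0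
  set M := (Finset.univ.filter fun d : G => χ (Additive.ofMul d) = 1).card with hMdef
  have hfib : ∀ g₀ : G, (Finset.univ.filter fun d : G => χ (Additive.ofMul d) = χ (Additive.ofMul g₀)).card = M := by
    intro g₀
    rw [hMdef, ← card_fibre_mul χ g₀ 1, mul_one]
  rw [isBalanced_indicator_iff, card_fibreSet hχ hζ1]
  intro g₀
  rw [Finset.filter_filter]
  have hsplit : (Finset.univ.filter fun d : G => (χ (Additive.ofMul d) = 1 ∨
      χ (Additive.ofMul d) = -χ (Additive.ofMul u) ^ p ^ j) ∧ g₀ * d ∈ Φ) =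
      (Finset.univ.filter fun d : G => χ (Additive.ofMul d) = 1 ∧ g₀ * d ∈ Φ) ∪
        (Finset.univ.filter fun d : G => χ (Additive.ofMul d) = -χ (Additive.ofMul u) ^ p ^ j ∧ g₀ * d ∈ Φ) := by
    ext d; simp only [Finset.mem_filter, Finset.mem_univ, true_and, Finset.mem_union]; tauto
  have hdisj : Disjoint (Finset.univ.filter fun d : G => χ (Additive.ofMul d) = 1 ∧ g₀ * d ∈ Φ)
      (Finset.univ.filter fun d : G => χ (Additive.ofMul d) = -χ (Additive.ofMul u) ^ p ^ j ∧ g₀ * d ∈ Φ) := by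
    rw [Finset.disjoint_filter]
    rintro d - ⟨h1, -⟩ ⟨h2, -⟩
    rw [h1] at h2
    exact hζ1 (by rw [h2, neg_neg])
  rw [hsplit, Finset.card_union_of_disjoint hdisj, card_filter_translate χ g₀ 1 (· ∈ Φ),
    card_filter_translate χ g₀ _ (· ∈ Φ), mul_one]
  have e1 : (Finset.univ.filter fun s : G => χ (Additive.ofMul s) = χ (Additive.ofMul g₀) ∧ s ∈ Φ) =
      Φ.filter fun s => χ (Additive.ofMul s) = χ (Additive.ofMul g₀) := by
    ext s; simp only [Finset.mem_filter, Finset.mem_univ, true_and]; tauto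
  have e2 : (Finset.univ.filter fun s : G =>
      χ (Additive.ofMul s) = χ (Additive.ofMul g₀) * -χ (Additive.ofMul u) ^ p ^ j ∧ s ∈ Φ) =
      Φ.filter fun s => χ (Additive.ofMul s) = -(χ (Additive.ofMul g₀) * χ (Additive.ofMul u) ^ p ^ j) := by
    ext s; simp only [Finset.mem_filter, Finset.mem_univ, true_and, mul_neg]; tauto
  rw [e1, e2, card_filter_neg h χ hχ, H g₀,
    show χ (Additive.ofMul g₀) * χ (Additive.ofMul u) ^ p ^ j = χ (Additive.ofMul (g₀ * u ^ p ^ j)) by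
      rw [char_mul, char_pow], hfib]
  have hle : (Φ.filter fun s => χ (Additive.ofMul s) = χ (Additive.ofMul g₀)).card ≤ M := by
    rw [← hfib g₀]
    exact Finset.card_le_card fun s hs => by
      simp only [Finset.mem_filter, Finset.mem_univ, true_and] at hs ⊢; exact hs.2
  omega

omit [DecidableEq G] hp in
/-- **`Δ` is not conjugation-symmetric**: `1 ∈ Δ`, `ρ ∉ Δ`. [cite: Hazama2003CyclicCM, §5] -/
theorem one_mem_rho_not_mem_fibreSet (hχ : χ (Additive.ofMul ρ) = -1)
    (hζ : χ (Additive.ofMul u) ^ p ^ j ≠ 1) :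
    (1 : G) ∈ (Finset.univ.filter fun d : G => χ (Additive.ofMul d) = 1 ∨
      χ (Additive.ofMul d) = -χ (Additive.ofMul u) ^ p ^ j) ∧
    ρ * 1 ∉ (Finset.univ.filter fun d : G => χ (Additive.ofMul d) = 1 ∨
      χ (Additive.ofMul d) = -χ (Additive.ofMul u) ^ p ^ j) := by
  constructor
  · rw [Finset.mem_filter, ofMul_one, AddChar.map_zero_eq_one]
    exact ⟨Finset.mem_univ _, Or.inl rfl⟩
  · rw [mul_one, Finset.mem_filter, hχ, not_and_or]
    refine Or.inr ?_
    rintro (h1 | h1)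
    · norm_num at h1
    · exact hζ (neg_inj.1 h1).symm

end Balanced

/-! ## §4 Groups of order `2p^k`: every vanishing odd character is of this kind -/

section PrimePowerOrder

/-- **The odd character with values `±1` never vanishes on a type** (`χ(S)` is a sum of `#S = p^k` signs).
[cite: Kubota1965, §4 Lemma 2] -/
theorem sum_char_ne_zero_of_sq_eq_one (hp2 : p ≠ 2) {k : ℕ} (hcard : Fintype.card G = 2 * p ^ k)
    (h : IsCMTypeWith ρ (Φ : Set G)) (χ : AddChar (Additive G) ℂ)
    (hsq : ∀ g : G, χ (Additive.ofMul g) ^ 2 = 1) : ∑ s ∈ Φ, χ (Additive.ofMul s) ≠ 0 := by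
  have hρ2 : ∀ g : G, ρ * (ρ * g) = g := fun g => by
    have := h.invol g; simpa [smul_eq_mul] using this
  have hΦ : Φ.card = p ^ k := by
    have hdisj : Disjoint Φ (Φ.image fun g => ρ * g) := by
      rw [Finset.disjoint_left]
      intro s hs hs'
      obtain ⟨t, ht, rfl⟩ := Finset.mem_image.1 hs'
      exact ((rho_mul_mem_iff h t).1 hs) ht
    have hcover : Φ ∪ Φ.image (fun g => ρ * g) = Finset.univ := by
      ext g
      simp only [Finset.mem_union, Finset.mem_univ, iff_true, Finset.mem_image]
      by_cases hg : g ∈ Φ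
      · exact Or.inl hg
      · exact Or.inr ⟨ρ * g, (rho_mul_mem_iff h g).2 hg, hρ2 g⟩
    have := congrArg Finset.card hcover
    rw [Finset.card_union_of_disjoint hdisj, Finset.card_image_of_injective _ (mul_right_injective ρ),
      Finset.card_univ, hcard] at this
    omega
  -- `χ(S) = #{χ = 1 on S} − #{χ = −1 on S}`, an odd integer
  have hsum : ∑ s ∈ Φ, χ (Additive.ofMul s) =
      ((Φ.filter fun s => χ (Additive.ofMul s) = 1).card : ℂ) -
        ((Φ.filter fun s => χ (Additive.ofMul s) = -1).card : ℂ) := by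
    rw [← Finset.sum_filter_add_sum_filter_not Φ (fun s => χ (Additive.ofMul s) = 1)]
    have e1 : ∑ s ∈ Φ.filter (fun s => χ (Additive.ofMul s) = 1), χ (Additive.ofMul s) =
        ((Φ.filter fun s => χ (Additive.ofMul s) = 1).card : ℂ) := by
      rw [Finset.card_eq_sum_ones, Nat.cast_sum, Nat.cast_one]
      exact Finset.sum_congr rfl fun s hs => (Finset.mem_filter.1 hs).2
    have hneg : (Φ.filter fun s => ¬ χ (Additive.ofMul s) = 1) = Φ.filter fun s => χ (Additive.ofMul s) = -1 := by
      refine Finset.filter_congr fun s _ => ?_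
      have := sq_eq_one_iff.1 (hsq s)
      constructor
      · intro hn; exact this.resolve_left hn
      · intro hm; rw [hm]; norm_num
    have e2 : ∑ s ∈ Φ.filter (fun s => ¬ χ (Additive.ofMul s) = 1), χ (Additive.ofMul s) =
        -((Φ.filter fun s => χ (Additive.ofMul s) = -1).card : ℂ) := by
      rw [hneg, Finset.card_eq_sum_ones, Nat.cast_sum, Nat.cast_one, ← Finset.sum_neg_distrib]
      exact Finset.sum_congr rfl fun s hs => (Finset.mem_filter.1 hs).2
    rw [e1, e2, sub_eq_add_neg]
  have htot : (Φ.filter fun s => χ (Additive.ofMul s) = 1).card +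
      (Φ.filter fun s => χ (Additive.ofMul s) = -1).card = p ^ k := by
    rw [← hΦ]
    have hneg : (Φ.filter fun s => χ (Additive.ofMul s) = -1) = Φ.filter fun s => ¬ χ (Additive.ofMul s) = 1 := by
      refine Finset.filter_congr fun s _ => ?_
      have := sq_eq_one_iff.1 (hsq s)
      constructor
      · intro hm; rw [hm]; norm_num
      · intro hn; exact this.resolve_left hn
    rw [hneg, Finset.card_filter_add_card_filter_not]
  obtain ⟨m, hm⟩ : Odd (p ^ k) := (hp.out.odd_of_ne_two hp2).pow
  rw [hsum, ← Int.cast_natCast, ← Int.cast_natCast (R := ℂ), ← Int.cast_sub, Int.cast_ne_zero]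
  omega

/-- **On a group of order `2p^k`, every odd character vanishing on a type has values in `μ_{2p^{j+1}}` with a
primitive `p^{j+1}`-th root of unity among them** (`j + 1 ≥ 1`: the character is not `±1`-valued): take `χ(g)²`
of maximal order `p^{j+1}` and `u = g²`. [cite: Kubota1965, §4 Lemma 2] -/
theorem exists_isPrimitiveRoot_of_sum_char_eq_zero (hp2 : p ≠ 2) {k : ℕ} (hcard : Fintype.card G = 2 * p ^ k)
    (h : IsCMTypeWith ρ (Φ : Set G)) (χ : AddChar (Additive G) ℂ)
    (h0 : ∑ s ∈ Φ, χ (Additive.ofMul s) = 0) :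
    ∃ (u : G) (j : ℕ), IsPrimitiveRoot (χ (Additive.ofMul u)) (p ^ (j + 1)) ∧
      ∀ g : G, χ (Additive.ofMul g) ^ (2 * p ^ (j + 1)) = 1 := by
  -- the orders of the squares `χ(g)²` are powers of `p`
  have hord : ∀ g : G, ∃ b ≤ k, orderOf (χ (Additive.ofMul g) ^ 2) = p ^ b := by
    intro g
    refine (Nat.dvd_prime_pow hp.out).1 (orderOf_dvd_of_pow_eq_one ?_)
    rw [← pow_mul, ← hcard]
    exact char_pow_card χ g
  obtain ⟨g₀, -, hmax⟩ := Finset.exists_max_image Finset.univ (fun g : G => orderOf (χ (Additive.ofMul g) ^ 2))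
    ⟨1, Finset.mem_univ _⟩
  obtain ⟨b₀, -, hb₀⟩ := hord g₀
  rcases Nat.eq_zero_or_pos b₀ with hb | hb
  · -- all values are `±1`: the character cannot vanish
    exfalso
    refine sum_char_ne_zero_of_sq_eq_one hp2 hcard h χ (fun g => ?_) h0
    obtain ⟨b, -, hb'⟩ := hord g
    have hle := hmax g (Finset.mem_univ _)
    rw [hb₀, hb, pow_zero, hb'] at hle
    have hb0 : b = 0 := by
      by_contra hne
      have h1 : p ^ 1 ≤ p ^ b := Nat.pow_le_pow_right hp.out.pos (Nat.pos_of_ne_zero hne)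
      have h2 := hp.out.one_lt
      rw [pow_one] at h1
      omega
    rw [hb0, pow_zero] at hb'
    exact orderOf_eq_one_iff.1 hb'
  · obtain ⟨j, rfl⟩ := Nat.exists_eq_add_one_of_ne_zero hb.ne'
    refine ⟨g₀ * g₀, j, ?_, fun g => ?_⟩
    · rw [char_mul, ← pow_two (χ (Additive.ofMul g₀)), IsPrimitiveRoot.iff_orderOf, hb₀]
    · obtain ⟨b, -, hb'⟩ := hord g
      have hle := hmax g (Finset.mem_univ _)
      rw [hb₀, hb'] at hle
      have hbj : b ≤ j + 1 := (Nat.pow_le_pow_iff_right hp.out.one_lt).1 hle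
      rw [pow_mul]
      apply orderOf_dvd_iff_pow_eq_one.1
      rw [hb']
      exact pow_dvd_pow p hbj

/-- **THE BALANCED SET OF A DEGENERATE TYPE on an abelian group of order `2p^k`** (`p` odd): if an odd character
`χ` vanishes on the CM type `S`, then `Δ = ker χ ∪ ρu^{p^j} ker χ` (for `χ(u)` a primitive `p^{j+1}`-th root of
unity of maximal level) is a balanced weight of size `2 · #ker χ` containing `1` and not `ρ` — the input of
Pohlmann's criterion for an exceptional Hodge class of codimension `#ker χ` (Lenstra: "for any abelian variety
with complex multiplication by an abelian CM-field there always exists a nondivisorial Hodge cycle on `A` itself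
if `A` is degenerate"). [cite: Hazama2003CyclicCM, Rem. 4.10 and §5] [cite: Gordon1999HodgeAVSurvey, 9.2.2 and §9.3] -/
theorem exists_balanced_of_sum_char_eq_zero (hp2 : p ≠ 2) {k : ℕ} (hcard : Fintype.card G = 2 * p ^ k)
    (h : IsCMTypeWith ρ (Φ : Set G)) (χ : AddChar (Additive G) ℂ) (hχ : χ (Additive.ofMul ρ) = -1)
    (h0 : ∑ s ∈ Φ, χ (Additive.ofMul s) = 0) :
    ∃ Δ : Finset G, Δ.card = 2 * (Finset.univ.filter fun d : G => χ (Additive.ofMul d) = 1).card ∧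
      IsBalanced G (Φ : Set G) (fun d => if d ∈ Δ then (1 : ℚ) else 0) ∧ (1 : G) ∈ Δ ∧ ρ * 1 ∉ Δ := by
  obtain ⟨u, j, hu, hall⟩ := exists_isPrimitiveRoot_of_sum_char_eq_zero hp2 hcard h χ h0
  have hprim : IsPrimitiveRoot (χ (Additive.ofMul u) ^ p ^ j) p :=
    hu.pow (pow_pos hp.out.pos _) (by rw [← pow_succ])
  have hζ : χ (Additive.ofMul u) ^ p ^ j ≠ 1 := hprim.ne_one hp.out.one_lt
  have hζ1 : χ (Additive.ofMul u) ^ p ^ j ≠ -1 := by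
    intro h1
    have := hprim.pow_eq_one
    rw [h1, (hp.out.odd_of_ne_two hp2).neg_one_pow] at this
    norm_num at this
  exact ⟨_, card_fibreSet hχ hζ1, isBalanced_fibreSet hp2 h hχ hu hall h0,
    one_mem_rho_not_mem_fibreSet hχ hζ⟩

omit hp in
/-- **The fibre size**: `1 ∈ ker χ` and `ρ ker χ = χ⁻¹(−1)` is disjoint from `ker χ`, so `0 < #ker χ` and
`#ker χ ≤ |G|/2`. [cite: Kubota1965, §4 Lemma 2 (proof)] -/
theorem card_ker_pos_le {χ : AddChar (Additive G) ℂ} (hχ : χ (Additive.ofMul ρ) = -1) {n : ℕ}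
    (hcard : Fintype.card G = 2 * n) :
    0 < (Finset.univ.filter fun d : G => χ (Additive.ofMul d) = 1).card ∧
      (Finset.univ.filter fun d : G => χ (Additive.ofMul d) = 1).card ≤ n := by
  refine ⟨Finset.card_pos.2 ⟨1, by simp⟩, ?_⟩
  have hdisj : Disjoint (Finset.univ.filter fun d : G => χ (Additive.ofMul d) = 1)
      (Finset.univ.filter fun d : G => χ (Additive.ofMul d) = -1) := by
    rw [Finset.disjoint_filter]
    intro d _ h1 h2
    rw [h1] at h2; norm_num at h2
  have h2 : (Finset.univ.filter fun d : G => χ (Additive.ofMul d) = -1).card =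
      (Finset.univ.filter fun d : G => χ (Additive.ofMul d) = 1).card := by
    rw [← card_fibre_mul χ ρ 1, hχ, mul_one]
  have := Finset.card_le_univ ((Finset.univ.filter fun d : G => χ (Additive.ofMul d) = 1) ∪
    (Finset.univ.filter fun d : G => χ (Additive.ofMul d) = -1))
  rw [Finset.card_union_of_disjoint hdisj, h2, hcard] at this
  omega

end PrimePowerOrder

end AbelianPrimePow

end CyclicCMType

end Literature.NumberTheory.ComplexMultiplication
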